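import Literature.AnabelianGeometry.EtaleTheta.GalSectDotCCuspOfTrivialisation
import Literature.AnabelianGeometry.EtaleTheta.SettingModelCyclotomicCharacterNontrivial
import Literature.AnabelianGeometry.EtaleTheta.SettingModelChiCusp
import Literature.AnabelianGeometry.AbsoluteAnabelian.ZHatCompletionAdicCompleteness
import HarnessLib

/-!
# [GalSect] §4 / [SemiAnbd] §6: the cusp inertia `I_x ≅ Ẑ(1)` WITH its Tate twist — the cyclotomic-inertia clause of
# [EtTh] Thm. 1.10 (iii)'s cusp datum (census item C7e, clause (1)), its non-vacuity at the `b`-axis cusp and its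
# EMPTINESS at every commutator-axis (untwisted) carrier

S. Mochizuki, *Galois sections in absolute anabelian geometry* [GalSect], Nagoya Math. J. **179** (2005), §4 p. 33:
«we have an exact sequence `1 → I_x → D_x → G_K → 1`, `I_x ≅ Ẑ(1)` … the splittings … form a torsor over
`H¹(G_K, Ẑ(1)) ≅ (K^×)^∧`» [cite: MochizukiGalSect2005, §4 p.33]; S. Mochizuki, *Semi-graphs of anabelioids* [SemiAnbd],
Publ. RIMS **42** (2006), §6 p. 71: «`I_x := D_x ∩ Δ^temp_X` is isomorphic to `Ẑ(1)` … if `x` is a cusp»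
[cite: MochizukiSemiAnbd2006, §6 p.71]; S. Mochizuki, *The étale theta function …* [EtTh], Publ. RIMS **45** (2009),
Thm. 1.10 (iii) p. 30 (the `(K^×_□)^∧`-torsor at the unique cusp of `Ċ^log_□`) [cite: MochizukiEtTh2009, Thm 1.10 (iii) p.30].

abc-iut cell, layer L2, seat abc-iut-w5-d029 (gen 6); abc-iut-L2-lead RULINGS #35 R404 (2026-08-26T13:20:36Z): census item
**C7e** («strengthen the torsor datum of `DotCCusp`: `eK` compatible with the Kummer map»), booked to this lane after
abc-iut-L2-t5's reading (13:15:28Z) that the bare trivialisation `eK : SplittingClass ≃ (K^×)^∧` of this seat's constructor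
`MuTwoSetting.DotCCusp.ofTrivialisation` (p447306) is inhabitable by CARDINALITY alone.  The `(1)` in «`Ẑ(1)`» is the
content the frozen records forget: `TemperedCurve.inertia_equiv_zHat` and `DotCCusp.inertia_equiv_zHat` give `I ≅ Ẑ` as
topological GROUPS only.  This file restores the Galois-module clause as a class (c) PREDICATE (no record edited, no field
added, no `Prop` fact, no instance) and settles its census on the whole model zoo:

* `GalSect.CuspPair.IsCyclotomic P α` — for a cuspidal pair `(D, I)` in a topological group `Γ` with an augmentation
  `α : Γ → G_{ℚ_p}`: `∃ e : I ≃ₜ* Ẑ` intertwining conjugation by `d ∈ D` with multiplication by `χ(α d)`, `χ` THE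
  cyclotomic character of `ℚ̄_p` (`SettingModel.chi`, abc-iut-w5-d091) — i.e. «`I ≅ Ẑ(1)` as a `D → G_K`-module»;
  `GalSect.IsCyclotomicCusp X x` (the pair `(D_x, I_x)` of a `TemperedCurve`, augmentation `aug`);
  `MuTwoSetting.DotCCusp.IsCyclotomicInertia C` (the pair of [EtTh] Thm. 1.10 (iii)'s cusp datum, augmentation `augC`).
* `CuspPair.isCyclotomic_pushforward_iff` — invariance under push-forward along an embedding (so the clause of a
  `DotCCusp` built by `ofTrivialisation` is the clause of the cusp `x` of `X` below: `isCyclotomicInertia_ofTrivialisation_iff`).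
* **NEGATIVE (generic)** `CuspPair.not_isCyclotomic_of_conj_eq` — if `I` is CENTRAL in `D` and `α(D)` is open, the pair is
  NOT cyclotomic: `χ` is non-trivial on every open subgroup of `G_{ℚ_p}` (`SettingModel.exists_mem_chi_ne_one_of_isOpen`,
  Neukirch ANT II (5.7) (i)) [cite: NeukirchANT1999, Ch. II Prop. (5.7) (i)].
* **NV POSITIVE** `SettingModel.isCyclotomicCusp_curveχ'` — at the `b`-axis cusp of the χ-twisted (Tate-shear) carrier
  `curveχ′` (p429840) conjugation by `(q, σ)` IS multiplication by `χ(σ)` on `I_x = b^Ẑ`: the predicate is inhabited.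
* **NEGATIVE (zoo)** `SettingModel.not_isCyclotomicCusp_curveκ'` — at the commutator-axis cusp of abc-iut-L2-t10's
  UNTWISTED Krull carrier `curveκ′` the inertia `c^Ẑ` is central in `D_x = c^Ẑ × G_{ℚ_p}`; hence
  `not_isCyclotomicInertia_dotCCuspκ'OfTrivialisation`: NO trivialisation `eK` makes the p447306 output cyclotomic.

CENSUS READING (row `MuTwoSetting.DotCCusp`, clause C7e (1)): «`DotCCusp` ∧ cyclotomic inertia» is EMPTY at every carrier in
hand — at the `b`-axis carriers `DotCCusp` itself is empty (p443644, p445383: the cusp ramifies in `Ẍ → X`), at the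
commutator-axis carriers the inertia is untwisted; the joint target is exactly GAP row G-L2t5-1 («CuspTwistAction»).  Clause
(2) (the `(K^×)^∧`-torsor IS the genuine `H¹`-torsor of `GalSectSplittingsCohomology`) is the sequel file.
HONEST FRAMING: [GalSect]/[SemiAnbd] are refereed; nothing of [EtTh] is asserted; semi-synthetic models are consistency
evidence only; no side taken on [IUTchIII] Cor. 3.12; typed ≠ proved.
-/

noncomputable section

namespace Literature.AnabelianGeometry.EtaleTheta

open Literature.AnabelianGeometry.SemiGraphs _root_.Topology
open scoped Pointwise

/-! ### §1. The cyclotomic clause for an abstract cuspidal pair -/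

namespace GalSect

namespace CuspPair

variable {Γ Γ' : Type*} [Group Γ] [TopologicalSpace Γ] [Group Γ'] [TopologicalSpace Γ']
variable {p : ℕ} [Fact p.Prime]

/-- `D` normalises `I`: `d · i · d⁻¹ ∈ I` for `d ∈ D`, `i ∈ I`. [cite: MochizukiGalSect2005, §4 p.33] -/
theorem conj_mem_I (P : CuspPair Γ) {d : Γ} (hd : d ∈ P.D) {i : Γ} (hi : i ∈ P.I) : d * i * d⁻¹ ∈ P.I := by
  have h : d * i * d⁻¹ ∈ MulAut.conj d • P.I :=
    (Subgroup.mem_smul_pointwise_iff_exists _ _ _).mpr ⟨i, hi, rfl⟩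
  rwa [P.conj_I d hd] at h

/-- **«`I ≅ Ẑ(1)`» — the CYCLOTOMIC clause of a cuspidal pair** `(D, I)` in `Γ` with respect to an augmentation
`α : Γ → G_{ℚ_p}`: there is an isomorphism of topological groups `e : I ≃ Ẑ` under which conjugation by `d ∈ D` is
multiplication by the cyclotomic character `χ(α d) ∈ Ẑ^× = Aut(Ẑ)` ([GalSect] §4 p. 33: `1 → I_x → D_x → G_K → 1` with
`I_x ≅ Ẑ(1)` as a `G_K`-module). Class (c) predicate; the frozen clause `inertia_equiv_zHat` is its shadow forgetting `(1)`.
[cite: MochizukiGalSect2005, §4 p.33] -/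
def IsCyclotomic (P : CuspPair Γ) (α : Γ →* GQp p) : Prop :=
  ∃ e : P.I ≃ₜ* ZHat, ∀ (d : Γ) (hd : d ∈ P.D) (i : P.I),
    e ⟨d * i * d⁻¹, P.conj_mem_I hd i.2⟩ = SettingModel.chi p (α d) (e i)

/-- `I ≃ₜ* f(I)` — `subgroupEquivMap` (p447043) at the type of the pushed pair's inertia.
[cite: MochizukiGalSect2005, §4 p.33] -/
def inertiaEquivMap (P : CuspPair Γ) (f : Γ →* Γ') (hc : Continuous f) (hf : IsEmbedding f) :
    ↥P.I ≃ₜ* ↥(P.pushforward f).I :=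
  subgroupEquivMap P.I f hc hf

/-- [cite: MochizukiGalSect2005, §4 p.33] -/
@[simp] theorem inertiaEquivMap_apply_coe (P : CuspPair Γ) (f : Γ →* Γ') (hc : Continuous f) (hf : IsEmbedding f)
    (x : P.I) : ((P.inertiaEquivMap f hc hf x : ↥(P.pushforward f).I) : Γ') = f x := rfl

/-- [cite: MochizukiGalSect2005, §4 p.33] -/
theorem coe_inertiaEquivMap_symm_apply (P : CuspPair Γ) (f : Γ →* Γ') (hc : Continuous f) (hf : IsEmbedding f)
    (y : ↥(P.pushforward f).I) : f ((P.inertiaEquivMap f hc hf).symm y : Γ) = (y : Γ') := by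
  rw [← inertiaEquivMap_apply_coe P f hc hf, ContinuousMulEquiv.apply_symm_apply]

/-- **Push-forward invariance**: along an embedding `f : Γ → Γ′` of topological groups, the pushed pair `(f D, f I)` is
cyclotomic for `α` iff `(D, I)` is cyclotomic for `α ∘ f`. [cite: MochizukiGalSect2005, §4 p.33] -/
theorem isCyclotomic_pushforward_iff (P : CuspPair Γ) {f : Γ →* Γ'} (hc : Continuous f) (hf : IsEmbedding f)
    (α : Γ' →* GQp p) : (P.pushforward f).IsCyclotomic α ↔ P.IsCyclotomic (α.comp f) := by
  constructor
  · rintro ⟨e', he'⟩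
    refine ⟨(P.inertiaEquivMap f hc hf).trans e', fun d hd i => ?_⟩
    have hfi : f (i : Γ) ∈ (P.pushforward f).I := ⟨i, i.2, rfl⟩
    have h1 : P.inertiaEquivMap f hc hf ⟨d * i * d⁻¹, P.conj_mem_I hd i.2⟩ =
        ⟨f d * f i * (f d)⁻¹, (P.pushforward f).conj_mem_I ⟨d, hd, rfl⟩ hfi⟩ :=
      Subtype.ext (by rw [inertiaEquivMap_apply_coe, map_mul, map_mul, map_inv])
    have h2 : P.inertiaEquivMap f hc hf i = ⟨f i, hfi⟩ := Subtype.ext (inertiaEquivMap_apply_coe P f hc hf i)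
    rw [ContinuousMulEquiv.trans_apply, ContinuousMulEquiv.trans_apply, h1, h2, he' (f d) ⟨d, hd, rfl⟩ ⟨f i, hfi⟩,
      MonoidHom.comp_apply]
  · rintro ⟨e, he⟩
    refine ⟨(P.inertiaEquivMap f hc hf).symm.trans e, ?_⟩
    rintro _ ⟨d, hd, rfl⟩ y
    obtain ⟨i, hi, hyi⟩ : ∃ i ∈ P.I, f i = (y : Γ') := y.2
    have h2 : (P.inertiaEquivMap f hc hf).symm y = ⟨i, hi⟩ := by
      apply (P.inertiaEquivMap f hc hf).injective
      rw [ContinuousMulEquiv.apply_symm_apply]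
      exact Subtype.ext (by rw [inertiaEquivMap_apply_coe]; exact hyi.symm)
    have h1 : (P.inertiaEquivMap f hc hf).symm ⟨f d * y * (f d)⁻¹, (P.pushforward f).conj_mem_I ⟨d, hd, rfl⟩ y.2⟩ =
        ⟨d * i * d⁻¹, P.conj_mem_I hd hi⟩ := by
      apply (P.inertiaEquivMap f hc hf).injective
      rw [ContinuousMulEquiv.apply_symm_apply]
      exact Subtype.ext (by rw [inertiaEquivMap_apply_coe, map_mul, map_mul, map_inv, hyi])
    rw [ContinuousMulEquiv.trans_apply, ContinuousMulEquiv.trans_apply, h1, h2, he d hd ⟨i, hi⟩, MonoidHom.comp_apply]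

/-- **NEGATIVE (generic): a pair with CENTRAL inertia and open Galois image is NOT cyclotomic.**  If every `d ∈ D`
commutes with every `i ∈ I` and `α(D) ≤ G_{ℚ_p}` is open, then `(D, I)` is not cyclotomic for `α`: the cyclotomic
character is non-trivial on every open subgroup of `G_{ℚ_p}` (finiteness of the roots of unity of a `p`-adic field),
while a central `I` would force `χ(α d) = 1` on all of `Ẑ` for every `d ∈ D`. [cite: NeukirchANT1999, Ch. II Prop. (5.7) (i)] -/
theorem not_isCyclotomic_of_conj_eq (P : CuspPair Γ) (α : Γ →* GQp p)
    (hcomm : ∀ d ∈ P.D, ∀ i ∈ P.I, d * i * d⁻¹ = i) (hopen : IsOpen (α '' (P.D : Set Γ))) :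
    ¬ P.IsCyclotomic α := by
  rintro ⟨e, he⟩
  have hopen' : IsOpen ((P.D.map α : Subgroup (GQp p)) : Set (GQp p)) := by rwa [Subgroup.coe_map]
  obtain ⟨σ, hσ, hne⟩ := SettingModel.exists_mem_chi_ne_one_of_isOpen p (P.D.map α) hopen'
  obtain ⟨d, hd, rfl⟩ := hσ
  apply hne
  ext t
  have key := he d hd (e.symm t)
  have hel : (⟨d * (e.symm t : P.I) * d⁻¹, P.conj_mem_I hd (e.symm t).2⟩ : P.I) = e.symm t :=
    Subtype.ext (hcomm d hd _ (e.symm t).2)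
  rw [hel, ContinuousMulEquiv.apply_symm_apply] at key
  rw [MulAut.one_apply]
  exact key.symm

end CuspPair

/-- **«`I_x ≅ Ẑ(1)`» at a cusp `x` of a tempered curve** ([SemiAnbd] §6 p. 71; [GalSect] §4 p. 33): the pair
`(D_x, I_x)` of `X` is cyclotomic for the augmentation `Π^tp_X → G_{ℚ_p}`.  Class (c) predicate over the frozen
`TemperedCurve` interface (abc-iut-L3), whose clause `inertia_equiv_zHat` records `I_x ≅ Ẑ` as groups only.
[cite: MochizukiSemiAnbd2006, §6 p.71] -/
def IsCyclotomicCusp {p : ℕ} [Fact p.Prime] (X : TemperedCurve p) (x : X.Pt) : Prop :=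
  (cuspPairOf X x).IsCyclotomic X.aug.toMonoidHom

/-- The generic negative at the curve level: central inertia (`D_x` centralises `I_x`) ⇒ the cusp is not cyclotomic
(`aug(D_x)` is open by the interface clause `isOpen_aug_decomp`). [cite: NeukirchANT1999, Ch. II Prop. (5.7) (i)] -/
theorem not_isCyclotomicCusp_of_conj_eq {p : ℕ} [Fact p.Prime] (X : TemperedCurve p) (x : X.Pt)
    (hcomm : ∀ d ∈ X.decomp x, ∀ i ∈ X.inertia x, d * i * d⁻¹ = i) : ¬ IsCyclotomicCusp X x :=
  (cuspPairOf X x).not_isCyclotomic_of_conj_eq X.aug.toMonoidHom hcomm (X.isOpen_aug_decomp x)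

end GalSect

/-! ### §2. The clause on [EtTh] Thm. 1.10 (iii)'s cusp datum `DotCCusp` -/

namespace MuTwoSetting

open GalSect

variable {p : ℕ} [Fact p.Prime] {M : MuTwoSetting p}

namespace DotCCusp

/-- **C7e, clause (1): the inertia of the cusp of `Ċ^log` is CYCLOTOMIC** — the pair `(D, I)` of the cusp datum is
cyclotomic for its augmentation `augC : Π^tp_C → G_{ℚ_p}` («`1 → I_x → D_x → G_K → 1`, `I_x ≅ Ẑ(1)`», [GalSect] §4
p. 33).  Class (c) predicate over abc-iut-w5-d062's v2 record (field `inertia_equiv_zHat` = its twist-forgetting shadow).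
[cite: MochizukiGalSect2005, §4 p.33] -/
def IsCyclotomicInertia {εZ : M.GtpC} (C : M.DotCCusp εZ) : Prop :=
  C.pair.IsCyclotomic C.augC

variable (e : M.CLevelData) (εZ : M.GtpC) {x : M.Pt} (hx : M.IsCusp x) (hD : M.decomp x ≤ M.GtpXdd)
  {S₀ : Subgroup M.PiTemp} (hS₀ : S₀ ∈ (cuspPairOf M.toTemperedCurve x).splittings)
  (eK : ((cuspPairOf M.toTemperedCurve x).pushforward M.inclX).SplittingClass ≃ KxHat M.toTemperedCurve)

/-- `augC ∘ inclX = aug` as homomorphisms. [cite: MochizukiEtTh2009, Def 1.7 p.27] -/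
theorem augC_comp_inclX : e.augC.toMonoidHom.comp M.inclX = M.aug.toMonoidHom :=
  MonoidHom.ext fun g => e.augC_inclX g

/-- **The clause of a `DotCCusp` built by `ofTrivialisation` is the clause of the cusp `x` of `X` below**
(push-forward along the closed embedding `inclX`, `augC ∘ inclX = aug`) — independently of the trivialisation `eK`.
[cite: MochizukiGalSect2005, §4 p.33] -/
theorem isCyclotomicInertia_ofTrivialisation_iff :
    (ofTrivialisation e εZ hx hD hS₀ eK).IsCyclotomicInertia ↔ IsCyclotomicCusp M.toTemperedCurve x := by
  unfold IsCyclotomicInertia IsCyclotomicCusp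
  rw [show (ofTrivialisation e εZ hx hD hS₀ eK).pair = (cuspPairOf M.toTemperedCurve x).pushforward M.inclX from rfl,
    show (ofTrivialisation e εZ hx hD hS₀ eK).augC = e.augC.toMonoidHom from rfl,
    CuspPair.isCyclotomic_pushforward_iff _ M.continuous_inclX (M.isClosedEmbedding_inclX e).isEmbedding,
    augC_comp_inclX]

end DotCCusp

end MuTwoSetting

/-! ### §3. The model zoo: non-vacuity at the `b`-axis cusp, emptiness at the commutator-axis cusp -/

namespace SettingModel

open GalSect MuTwoSetting
open Literature.AnabelianGeometry.AbsoluteAnabelian (ZHatCompletion.mul_comm)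

variable (p : ℕ) [Fact p.Prime]

/-! #### `curveχ′` (χ-twisted, Tate shear on the `b`-axis): the cusp IS cyclotomic -/

/-- Elements of the `b`-axis commute. [cite: MochizukiEtTh2009, §1 p.12] -/
theorem bAxisGfp_comm {q r : Gfp} (hq : q ∈ bAxisGfp) (hr : r ∈ bAxisGfp) : q * r = r * q := by
  obtain ⟨s, rfl⟩ := hq
  obtain ⟨t, rfl⟩ := hr
  change bPowGfp s * bPowGfp t = bPowGfp t * bPowGfp s
  rw [← map_mul, ← map_mul, ZHatCompletion.mul_comm]

/-- **Conjugation on the `b`-axis inertia of `curveχ′` is the cyclotomic character**: for `d ∈ D_x = b^Ẑ ⋊ G_{ℚ_p}`,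
`d · inl(b^t) · d⁻¹ = inl(b^{χ(aug d) t})`. [cite: MochizukiEtTh2009, §1 p.13] -/
theorem conj_inl_bPowGfp_of_mem_cuspDecompχ {d : PiTpχ p} (hd : d ∈ cuspDecompχ p) (t : ZHat) :
    d * SemidirectProduct.inl (bPowGfp t) * d⁻¹ = SemidirectProduct.inl (bPowGfp (chi p (augχ p d) t)) := by
  have hdl : d.left ∈ bAxisGfp := hd
  refine SemidirectProduct.ext ?_ ?_
  · rw [SemidirectProduct.mul_left, SemidirectProduct.mul_left, SemidirectProduct.inv_left,
      SemidirectProduct.mul_right, SemidirectProduct.right_inl, mul_one, SemidirectProduct.left_inl,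
      ← MulAut.mul_apply, ← map_mul, mul_inv_cancel, map_one, MulAut.one_apply, actχ_apply, twistGfp_bPowGfp,
      augχ_apply]
    rw [bAxisGfp_comm hdl (bPowGfp_mem_bAxisGfp _), mul_assoc, mul_inv_cancel, mul_one, SemidirectProduct.left_inl]
  · rw [SemidirectProduct.mul_right, SemidirectProduct.mul_right, SemidirectProduct.inv_right,
      SemidirectProduct.right_inl, mul_one, mul_inv_cancel, SemidirectProduct.right_inl]

/-- The inverse of `inertiaEquivχ` on the nose: `t ↦ inl(b^t)`. [cite: MochizukiSemiAnbd2006, §6 p.71] -/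
theorem inertiaEquivχ_symm_apply_coe (t : ZHat) :
    (((inertiaEquivχ p).symm t : ↥(cuspDecompχ p ⊓ (augχ p).toMonoidHom.ker)) : PiTpχ p) =
      SemidirectProduct.inl (bPowGfp t) := rfl

/-- **NV POSITIVE: the `b`-axis cusp of `curveχ′` is cyclotomic** («`I_x ≅ Ẑ(1)`» holds there WITH the twist: the
Tate shear acts on `b^Ẑ` through `χ`). [cite: MochizukiSemiAnbd2006, §6 p.71] -/
theorem isCyclotomicCusp_curveχ' : IsCyclotomicCusp (curveχ' p) () := by
  refine ⟨inertiaEquivχ p, fun d hd i => ?_⟩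
  set t : ZHat := inertiaEquivχ p i with ht
  have hi : (i : PiTpχ p) = SemidirectProduct.inl (bPowGfp t) := by
    rw [← inertiaEquivχ_symm_apply_coe p t, ht, ContinuousMulEquiv.symm_apply_apply]
  have hconj : (⟨d * i * d⁻¹, (cuspPairOf (curveχ' p) ()).conj_mem_I hd i.2⟩ :
      ↥(cuspDecompχ p ⊓ (augχ p).toMonoidHom.ker)) = (inertiaEquivχ p).symm (chi p (augχ p d) t) := by
    apply Subtype.ext
    rw [inertiaEquivχ_symm_apply_coe]
    change d * (i : PiTpχ p) * d⁻¹ = _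
    rw [hi]
    exact conj_inl_bPowGfp_of_mem_cuspDecompχ p hd t
  change inertiaEquivχ p ⟨d * i * d⁻¹, _⟩ = chi p (augχ p d) (inertiaEquivχ p i)
  rw [hconj, ContinuousMulEquiv.apply_symm_apply]

/-! #### `curveκ′` (untwisted Krull carrier, commutator-axis cusp): the cusp is NOT cyclotomic -/

/-- Elements of the commutator axis `c^Ẑ ⊆ Γ` commute. [cite: MochizukiEtTh2009, §1 p.12] -/
theorem cAxisGfp_comm {q r : Gfp} (hq : q ∈ cAxisGfp) (hr : r ∈ cAxisGfp) : q * r = r * q := by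
  obtain ⟨s, rfl⟩ := hq
  obtain ⟨t, rfl⟩ := hr
  change cPowGfp s * cPowGfp t = cPowGfp t * cPowGfp s
  rw [← map_mul, ← map_mul, ZHatCompletion.mul_comm]

/-- **At `curveκ′` the cusp inertia is CENTRAL in its decomposition group**: `D_x = c^Ẑ × G_{ℚ_p}` (trivial action),
`I_x = inl(c^Ẑ)`. [cite: MochizukiEtTh2009, §1 p.13] -/
theorem conj_eq_of_mem_inertia_curveκ' {d i : PiTpκ p} (hd : d ∈ (curveκ' p).decomp ())
    (hi : i ∈ (curveκ' p).inertia ()) : d * i * d⁻¹ = i := by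
  have hi' : i ∈ cuspDecompκ p ⊓ (augκ p).toMonoidHom.ker := hi
  rw [cuspDecompκ_inf_ker] at hi'
  obtain ⟨q, hq, rfl⟩ := hi'
  have hdl : d.left ∈ cAxisGfp := hd
  refine SemidirectProduct.ext ?_ ?_
  · rw [SemidirectProduct.mul_left, SemidirectProduct.mul_left, SemidirectProduct.inv_left,
      SemidirectProduct.left_inl, actκ_apply_eq, actκ_apply_eq, actκ_apply_eq,
      cAxisGfp_comm hdl hq, mul_assoc, mul_inv_cancel, mul_one]
  · rw [SemidirectProduct.mul_right, SemidirectProduct.mul_right, SemidirectProduct.inv_right,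
      SemidirectProduct.right_inl, mul_one, mul_inv_cancel]

/-- **NEGATIVE: the commutator-axis cusp of the untwisted Krull carrier `curveκ′` is NOT cyclotomic** (central
inertia; `aug(D_x) = G_{ℚ_p}` open; `χ ≠ 1` on every open subgroup). [cite: NeukirchANT1999, Ch. II Prop. (5.7) (i)] -/
theorem not_isCyclotomicCusp_curveκ' : ¬ IsCyclotomicCusp (curveκ' p) () :=
  not_isCyclotomicCusp_of_conj_eq (curveκ' p) () fun _ hd _ hi => conj_eq_of_mem_inertia_curveκ' p hd hi

/-- **C7e (1) census at `inversionModelκ′`: for EVERY trivialisation `eK` and every `ε_Z`, the cusp datum produced by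
`dotCCuspκ′OfTrivialisation` (p447306) has NON-cyclotomic inertia** — so the only `DotCCusp` producer in the tree
never meets clause (1); the joint target «`DotCCusp` ∧ cyclotomic inertia» is GAP row G-L2t5-1.
[cite: MochizukiEtTh2009, Thm 1.10 (iii) p.30] -/
theorem not_isCyclotomicInertia_dotCCuspκ'OfTrivialisation (εZ : (MuTwoSetting.inversionModelκ' p).GtpC)
    (eK : ((cuspPairOf (curveκ' p) ()).pushforward (inclInvκ p)).SplittingClass ≃ KxHat (curveκ' p)) :
    ¬ (dotCCuspκ'OfTrivialisation p εZ eK).IsCyclotomicInertia := by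
  intro h
  have h' := (DotCCusp.isCyclotomicInertia_ofTrivialisation_iff (M := MuTwoSetting.inversionModelκ' p)
    (cLevelDataInvκ' p) εZ (x := ()) trivial (decomp_le_GtpXdd_inversionModelκ' p ())
    (inrSplittingκ' p) eK).mp h
  exact not_isCyclotomicCusp_curveκ' p h'

end SettingModel

end Literature.AnabelianGeometry.EtaleTheta

end
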